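import Summits.NavierStokesRegularity.NavierStokesRegularity.Theses.MarginalReynoldsCreep
import HarnessLib

/-!
# Line `amplification-relaxation` — skeleton of crux `NoBreathing` (stmt-NavierStokesRegularity-13639)

Crux-strategist line = the typed decomposition itself: the two registered stubs ARE the two pieces filed
on the route (stub_amplificationHorizon = item 17672 `AmplificationHorizon`, stub_noLateRelaxation = item
17673 `NoLateRelaxation`, verbatim), and `NoBreathing_of` is the PROVED assembly (window induction +
covering, ≈200 lines; same proof as `Cruxes/NoBreathing/Split.lean` and the glue item 17688).  See
`Lines/amplification-relaxation.md` and `STRATEGY-CENSUS.md`.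
-/

noncomputable section

set_option linter.dupNamespace false
set_option linter.unusedVariables false

namespace Summit.NavierStokesRegularity.NavierStokesRegularity.Cruxes.NoBreathing.AmplificationRelaxation

open MeasureTheory Set Function Filter Topology
open Literature.Analysis.FluidPDE
open scoped ENNReal NNReal

local notation "ℝ³" => EuclideanSpace ℝ (Fin 3)

/-- STUB = piece X₁ (route item stmt-NavierStokesRegularity-17672 `AmplificationHorizon`, verbatim):
level-uniform amplification horizon after late Type-I(M) slices. -/
theorem stub_amplificationHorizon :
    ∀ (ν T : ℝ), 0 < ν → 0 < T → ∀ (u : ℝ → ℝ³ → ℝ³) (p : ℝ → ℝ³ → ℝ), IsMaximalSmoothSolution ν 0 u p T → IsLerayHopfOn T ν 0 (u 0) u → HasRapidSpatialDecay (u 0) → ¬ IsTypeIBlowup u T → ∃ τ₀ : ℝ, 0 < τ₀ ∧ ∀ M : ℝ, 0 < M → ∃ G : ℝ, ∀ᶠ t₀ in 𝓝[<] T, (∀ x, (T - t₀) * ‖u t₀ x‖ ^ 2 ≤ M) → ∀ t : ℝ, t₀ ≤ t → Real.exp (-τ₀) * (T - t₀) ≤ T - t → ∀ x, (T - t) * ‖u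 t x‖ ^ 2 ≤ G := by
  sorry

/-- STUB = piece X₂ (route item stmt-NavierStokesRegularity-17673 `NoLateRelaxation`, verbatim):
no Type-I(M) slice after a late super-M stretch of log-length `L(M)`. -/
theorem stub_noLateRelaxation :
    ∀ (ν T : ℝ), 0 < ν → 0 < T → ∀ (u : ℝ → ℝ³ → ℝ³) (p : ℝ → ℝ³ → ℝ), IsMaximalSmoothSolution ν 0 u p T → IsLerayHopfOn T ν 0 (u 0) u → HasRapidSpatialDecay (u 0) → ¬ IsTypeIBlowup u T → ∀ M : ℝ, 0 < M → ∃ L : ℝ, 0 < L ∧ ∀ᶠ s in 𝓝[<] T, ∀ t : ℝ, s < t → t < T → T - t ≤ Real.exp (-L) * (T - s) → (∀ r : ℝ, s < r → r ≤ t → ∃ x, M < (T - r) * ‖u r x‖ ^ 2) → ∀ t' : ℝ, t ≤ t' → t' < T → ∃ x, M < (T - t') * ‖u t' x‖ ^ 2 := by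
  sorry

/-! ### Filter bookkeeping near the blow-up time -/

theorem eventually_nhdsLT_iff {T : ℝ} {P : ℝ → Prop} :
    (∀ᶠ t in 𝓝[<] T, P t) ↔ ∃ a < T, ∀ t, a < t → t < T → P t := by
  rw [(nhdsLT_basis T).eventually_iff]
  constructor
  · rintro ⟨a, ha, h⟩
    exact ⟨a, ha, fun t h1 h2 => h ⟨h1, h2⟩⟩
  · rintro ⟨a, ha, h⟩
    exact ⟨a, ha, fun t ht => h t ht.1 ht.2⟩

theorem frequently_nhdsLT_iff {T : ℝ} {P : ℝ → Prop} :
    (∃ᶠ t in 𝓝[<] T, P t) ↔ ∀ a < T, ∃ t, a < t ∧ t < T ∧ P t := by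
  rw [(nhdsLT_basis T).frequently_iff]
  constructor
  · intro h a ha
    obtain ⟨t, ht, hP⟩ := h a ha
    exact ⟨t, ht.1, ht.2, hP⟩
  · intro h a ha
    obtain ⟨t, h1, h2, hP⟩ := h a ha
    exact ⟨t, ⟨h1, h2⟩, hP⟩

/-- Not Type I ⇒ spikes of every height recur: for every `H > 0` and `a < T` there are
`t ∈ (a, T)` and `x` with `(T - t)|u(t,x)|² > H`. -/
theorem spikes_of_not_isTypeIBlowup {u : ℝ → ℝ³ → ℝ³} {T : ℝ}
    (hnI : ¬ IsTypeIBlowup u T) {H : ℝ} (hH : 0 < H) :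
    ∀ a < T, ∃ t, a < t ∧ t < T ∧ ∃ x, H < (T - t) * ‖u t x‖ ^ 2 := by
  intro a ha
  have hnot : ¬ ∀ᶠ t in 𝓝[<] T, ∀ x, ‖u t x‖ ≤ Real.sqrt H / Real.sqrt (T - t) :=
    fun hev => hnI ⟨Real.sqrt H, hev⟩
  have hfr : ∃ᶠ t in 𝓝[<] T, ∃ x, Real.sqrt H / Real.sqrt (T - t) < ‖u t x‖ := by
    have h1 := Filter.not_eventually.1 hnot
    exact h1.mono fun t ht => by push Not at ht; exact ht
  obtain ⟨t, h1, h2, x, hx⟩ := frequently_nhdsLT_iff.1 hfr a ha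
  refine ⟨t, h1, h2, x, ?_⟩
  have hTt : 0 < T - t := sub_pos.2 h2
  have hnn : 0 ≤ Real.sqrt H / Real.sqrt (T - t) := by positivity
  have hsq : (Real.sqrt H / Real.sqrt (T - t)) ^ 2 < ‖u t x‖ ^ 2 :=
    pow_lt_pow_left₀ hx hnn two_ne_zero
  have hsq' : (Real.sqrt H / Real.sqrt (T - t)) ^ 2 = H / (T - t) := by
    rw [div_pow, Real.sq_sqrt hH.le, Real.sq_sqrt hTt.le]
  rw [hsq', div_lt_iff₀ hTt] at hsq
  linarith

/-! ### Step 1 — concatenating windows: horizon `n τ₀` for every `n` -/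

/-- From a uniform horizon `τ₀` at every level, late Type-I(M) slices are followed by bounded
coupling over the horizon `n τ₀`, for every `n : ℕ` (restart at the end slice of each window at
level `max(G,1)`). -/
theorem horizon_iterate {u : ℝ → ℝ³ → ℝ³} {T τ₀ : ℝ} (hτ₀ : 0 < τ₀)
    (hor : ∀ M : ℝ, 0 < M → ∃ G : ℝ, ∀ᶠ t₀ in 𝓝[<] T,
      (∀ x, (T - t₀) * ‖u t₀ x‖ ^ 2 ≤ M) →
        ∀ t : ℝ, t₀ ≤ t → Real.exp (-τ₀) * (T - t₀) ≤ T - t → ∀ x, (T - t) * ‖u t x‖ ^ 2 ≤ G) :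
    ∀ n : ℕ, ∀ M : ℝ, 0 < M → ∃ G : ℝ, ∃ a < T, ∀ t₀, a < t₀ → t₀ < T →
      (∀ x, (T - t₀) * ‖u t₀ x‖ ^ 2 ≤ M) →
        ∀ t : ℝ, t₀ ≤ t → Real.exp (-(n * τ₀)) * (T - t₀) ≤ T - t →
          ∀ x, (T - t) * ‖u t x‖ ^ 2 ≤ G := by
  intro n
  induction n with
  | zero =>
    intro M hM
    refine ⟨M, T - 1, by linarith, ?_⟩
    intro t₀ _ ht₀T hdip t ht₀t hwin x
    have hw : T - t₀ ≤ T - t := by simpa using hwin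
    have htt₀ : t = t₀ := le_antisymm (by linarith) ht₀t
    rw [htt₀]
    exact hdip x
  | succ n ih =>
    intro M hM
    obtain ⟨G₁, a₁, ha₁, h1⟩ := ih M hM
    have hG₁' : 0 < max G₁ 1 := lt_max_of_lt_right one_pos
    obtain ⟨G₂, hG₂⟩ := hor (max G₁ 1) hG₁'
    obtain ⟨a₂, ha₂, h2⟩ := eventually_nhdsLT_iff.1 hG₂
    refine ⟨max (max G₁ 1) G₂, max a₁ a₂, max_lt ha₁ ha₂, ?_⟩
    intro t₀ hat₀ ht₀T hdip t ht₀t hwin x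
    have ha₁t₀ : a₁ < t₀ := lt_of_le_of_lt (le_max_left _ _) hat₀
    have ha₂t₀ : a₂ < t₀ := lt_of_le_of_lt (le_max_right _ _) hat₀
    by_cases hcase : Real.exp (-(n * τ₀)) * (T - t₀) ≤ T - t
    · exact (h1 t₀ ha₁t₀ ht₀T hdip t ht₀t hcase x).trans
        ((le_max_left _ _).trans (le_max_left _ _))
    · push Not at hcase
      -- the intermediate slice `t₁ := T - e^{-n τ₀}(T - t₀)` is Type-I(max G₁ 1)
      set t₁ : ℝ := T - Real.exp (-(n * τ₀)) * (T - t₀) with ht₁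
      have hTt₀ : 0 < T - t₀ := sub_pos.2 ht₀T
      have hexp_pos : 0 < Real.exp (-(n * τ₀)) := Real.exp_pos _
      have hexp_le : Real.exp (-(n * τ₀)) ≤ 1 := by
        rw [Real.exp_le_one_iff, neg_nonpos]
        positivity
      have hTt₁ : T - t₁ = Real.exp (-(n * τ₀)) * (T - t₀) := by rw [ht₁]; ring
      have ht₀t₁ : t₀ ≤ t₁ := by
        have : Real.exp (-(n * τ₀)) * (T - t₀) ≤ T - t₀ := mul_le_of_le_one_left hTt₀.le hexp_le
        linarith
      have ht₁T : t₁ < T := by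
        have : 0 < Real.exp (-(n * τ₀)) * (T - t₀) := mul_pos hexp_pos hTt₀
        linarith
      have hdip₁ : ∀ y, (T - t₁) * ‖u t₁ y‖ ^ 2 ≤ max G₁ 1 := fun y =>
        (h1 t₀ ha₁t₀ ht₀T hdip t₁ ht₀t₁ (le_of_eq hTt₁.symm) y).trans (le_max_left _ _)
      have ha₂t₁ : a₂ < t₁ := lt_of_lt_of_le ha₂t₀ ht₀t₁
      have ht₁t : t₁ ≤ t := by linarith
      have hwin' : Real.exp (-τ₀) * (T - t₁) ≤ T - t := by
        rw [hTt₁, ← mul_assoc, ← Real.exp_add]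
        have : -τ₀ + -(↑n * τ₀) = -(↑(n + 1) * τ₀) := by push_cast; ring
        rw [this]
        exact hwin
      exact (h2 t₁ ha₂t₁ ht₁T hdip₁ t ht₁t hwin' x).trans (le_max_right _ _)

/-! ### Step 2 — the covering argument: the assembly -/

/-- **The skeleton theorem: `NoBreathing` from the two registered stubs** (= the proved assembly of the
split, with the stubs in place of the pieces; see `Cruxes/NoBreathing/Split.lean` for the parametric form). -/
theorem NoBreathing_of :
    Summit.NavierStokesRegularity.NavierStokesRegularity.Theses.MarginalReynoldsCreep.NoBreathing := by
  intro ν T hν hT u p hmax hLH hdec hnI M₀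
  obtain ⟨τ₀, hτ₀, hor⟩ := stub_amplificationHorizon ν T hν hT u p hmax hLH hdec hnI
  have hrel := stub_noLateRelaxation ν T hν hT u p hmax hLH hdec hnI
  have step := horizon_iterate hτ₀ hor
  by_contra hcon
  -- breathing: Type-I(M₀) slices recur
  have hfreq : ∃ᶠ t in 𝓝[<] T, ∀ x, (T - t) * ‖u t x‖ ^ 2 < M₀ := by
    have h1 := Filter.not_eventually.1 hcon
    exact h1.mono fun t ht => by push Not at ht; exact ht
  set M : ℝ := max M₀ 1 with hMdef
  have hM : 0 < M := lt_max_of_lt_right one_pos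
  have hdips : ∀ a < T, ∃ t, a < t ∧ t < T ∧ ∀ x, (T - t) * ‖u t x‖ ^ 2 ≤ M := by
    intro a ha
    obtain ⟨t, h1, h2, h3⟩ := frequently_nhdsLT_iff.1 hfreq a ha
    exact ⟨t, h1, h2, fun x => (h3 x).le.trans (le_max_left _ _)⟩
  -- X₂ at level M
  obtain ⟨L, hL, hrelM⟩ := hrel M hM
  obtain ⟨a₂, ha₂, hR⟩ := eventually_nhdsLT_iff.1 hrelM
  -- horizon n τ₀ ≥ L from Step 1
  obtain ⟨n, hn⟩ : ∃ n : ℕ, L ≤ n * τ₀ := by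
    obtain ⟨n, hn⟩ := Archimedean.arch L hτ₀
    exact ⟨n, by simpa [nsmul_eq_mul] using hn⟩
  obtain ⟨G, a₁, ha₁, hG⟩ := step n M hM
  set H : ℝ := max G 0 + 1 with hHdef
  have hH0 : 0 < H := by have := le_max_right G 0; linarith
  have hGH : G < H := by have := le_max_left G 0; linarith
  -- thresholds
  set a₀ : ℝ := max a₁ a₂ with ha₀def
  have ha₀T : a₀ < T := max_lt ha₁ ha₂
  have heLpos : 0 < Real.exp (-L) := Real.exp_pos _
  have heL1 : Real.exp (-L) < 1 := by rw [Real.exp_lt_one_iff]; linarith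
  have hee : Real.exp (-L) * Real.exp L = 1 := by rw [← Real.exp_add]; simp
  set a₃ : ℝ := T - Real.exp (-L) * (T - a₀) with ha₃def
  have ha₃T : a₃ < T := by
    have : 0 < Real.exp (-L) * (T - a₀) := mul_pos heLpos (sub_pos.2 ha₀T)
    linarith
  -- a late spike of height > H
  obtain ⟨t₁, hat₁, ht₁T, x₁, hx₁⟩ := spikes_of_not_isTypeIBlowup hnI hH0 a₃ ha₃T
  have hTt₁ : 0 < T - t₁ := sub_pos.2 ht₁T
  -- the start of its run-up window of log-length L
  set s₁ : ℝ := T - Real.exp L * (T - t₁) with hs₁def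
  have hTs₁ : T - s₁ = Real.exp L * (T - t₁) := by rw [hs₁def]; ring
  have hs₁t₁ : s₁ < t₁ := by
    have h1L : 1 < Real.exp L := Real.one_lt_exp_iff.2 hL
    have : T - t₁ < Real.exp L * (T - t₁) := lt_mul_of_one_lt_left hTt₁ h1L
    linarith
  have hs₁a₀ : a₀ < s₁ := by
    have h1 : T - t₁ < T - a₃ := by linarith
    have h2 : T - a₃ = Real.exp (-L) * (T - a₀) := by rw [ha₃def]; ring
    have h3 : Real.exp L * (T - t₁) < Real.exp L * (Real.exp (-L) * (T - a₀)) := by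
      rw [← h2]; exact mul_lt_mul_of_pos_left h1 (Real.exp_pos L)
    have h4 : Real.exp L * (Real.exp (-L) * (T - a₀)) = T - a₀ := by
      rw [← mul_assoc, mul_comm (Real.exp L), hee, one_mul]
    linarith
  have hs₁a₁ : a₁ < s₁ := lt_of_le_of_lt (le_max_left _ _) hs₁a₀
  have hs₁a₂ : a₂ < s₁ := lt_of_le_of_lt (le_max_right _ _) hs₁a₀
  have hs₁T : s₁ < T := hs₁t₁.trans ht₁T
  -- the run-up window (s₁, t₁] contains no Type-I(M) slice (Step 1 would cap the spike at G < H)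
  have hfree : ∀ r, s₁ < r → r ≤ t₁ → ∃ x, M < (T - r) * ‖u r x‖ ^ 2 := by
    intro r hsr hrt
    by_contra hno
    push Not at hno
    have har : a₁ < r := hs₁a₁.trans hsr
    have hrT : r < T := lt_of_le_of_lt hrt ht₁T
    have hTr : 0 < T - r := sub_pos.2 hrT
    have hwin : Real.exp (-(n * τ₀)) * (T - r) ≤ T - t₁ := by
      have h1 : Real.exp (-(n * τ₀)) ≤ Real.exp (-L) := Real.exp_le_exp.2 (by linarith)
      have h2 : T - r < Real.exp L * (T - t₁) := by rw [← hTs₁]; linarith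
      have h3 : Real.exp (-L) * (T - r) < T - t₁ := by
        calc Real.exp (-L) * (T - r) < Real.exp (-L) * (Real.exp L * (T - t₁)) :=
              mul_lt_mul_of_pos_left h2 heLpos
          _ = T - t₁ := by rw [← mul_assoc, hee, one_mul]
      calc Real.exp (-(n * τ₀)) * (T - r) ≤ Real.exp (-L) * (T - r) :=
            mul_le_mul_of_nonneg_right h1 hTr.le
        _ ≤ T - t₁ := h3.le
    have hcap := hG r har hrT hno t₁ hrt hwin x₁
    linarith
  -- X₂: no Type-I(M) slice after t₁ ...
  have hwin₁ : T - t₁ ≤ Real.exp (-L) * (T - s₁) := by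
    rw [hTs₁, ← mul_assoc, hee, one_mul]
  have hnodip : ∀ t', t₁ ≤ t' → t' < T → ∃ x, M < (T - t') * ‖u t' x‖ ^ 2 :=
    hR s₁ hs₁a₂ hs₁T t₁ hs₁t₁ ht₁T hwin₁ hfree
  -- ... but Type-I(M) slices recur
  obtain ⟨t', h1, h2, hdip'⟩ := hdips t₁ ht₁T
  obtain ⟨x, hx⟩ := hnodip t' h1.le h2
  exact absurd (hdip' x) (not_le.2 hx)


end Summit.NavierStokesRegularity.NavierStokesRegularity.Cruxes.NoBreathing.AmplificationRelaxation
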